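import Summits.QuantumFields.QCD.Theorems.TiltedFlatness.Negative.FreeStarFibre

/-!
# Crux `TiltedFlatness` (K3 of `PauliWegnerSea`), negative side — the constants depend on `N_f`

Support file of the standing disprover of item stmt-QuantumFields-14070.

**Theorem `not_tiltedFlatness_uniform_in_Nf`.**  The repaired crux `C′` with its constants
`C, p, c` quantified BEFORE `N_f` (everything else verbatim) is FALSE, already at `β = 0` and
through clause (b′) alone: on the free one-star fibre (`FreeStarFibre.lean`: `L = 4`, `U ≡ 1`,
`x = y = 0`, all masses `0`) the weight is `F = G^{N_f}` with `G = |det D_W(·; 0)|` continuous,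
`G = 0` at the trivial star and `G > 0` at the twisted one; `M ≥ θ^{N_f} Haar(G > θ)`
(`θ = G(twist)/2`), so the relative small ball `{F ≤ εM}` contains the fixed open set
`{G < θ/2} ∋ 1` as soon as `2^{-N_f} ≤ ε · Haar(G > θ)`, and its Haar mass does not go to zero
with `ε`.  Hence the degree (`6N_f` per link) of the band-limited family MUST enter the
constants, exactly as the crux allows.  Standard material. [folklore]
-/

namespace Summit.QuantumFields.QCD.Theorems.TiltedFlatnessNegative

open Matrix
open Literature.MathematicalPhysics.QuantumFieldTheory Literature.MathematicalPhysics.QuantumLattice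
  Literature.Probability.LatticeModels

section NfDependence

/-- **The constants of `TiltedFlatness` cannot be uniform in `N_f`.**  With `C, p, c` quantified
BEFORE `N_f` (everything else verbatim) the statement is FALSE, already at `β = 0` and through
clause (b′) alone: on the free one-star fibre (`L = 4`, `U ≡ 1`, `x = y = 0`, all masses `0`) the
weight is `F = G^{N_f}` with `G = |det D_W(·; 0)|` continuous, `G = 0` at the trivial star and
`G > 0` at the twisted one; `M_{N_f} ≥ θ^{N_f} Haar(G > θ)` (`θ = G(twist)/2`), so the relative
small ball `{F ≤ ε M}` contains the fixed open set `{G < θ/2} ∋ 1` as soon as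
`2^{-N_f} ≤ ε · Haar(G > θ)`, and its Haar mass does not go to zero with `ε`.  Hence the degree
(`6N_f` per link) of the band-limited family MUST enter the constants, as the crux allows.
[folklore] -/
theorem not_tiltedFlatness_uniform_in_Nf :
    ¬ (∃ C p c : ℝ, 0 < C ∧ 0 < c ∧ ∀ (Nf : ℕ) (β : ℝ), 0 ≤ β → ∀ mq : Fin Nf → ℝ,
        (∀ f, -2 ≤ mq f ∧ mq f ≤ 2) → ∀ (L : ℕ) [NeZero L], 4 ≤ L →
        ∀ (U : GaugeConfig 4 L (Matrix.specialUnitaryGroup (Fin 3) ℂ)) (x y : TorusSite 4 L),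
        let star : Edge 4 L → Prop := fun e =>
          e.1 = x ∨ Site.shift e.1 e.2 = x ∨ e.1 = y ∨ Site.shift e.1 e.2 = y
        let refit : GaugeConfig 4 L (Matrix.specialUnitaryGroup (Fin 3) ℂ) →
            GaugeConfig 4 L (Matrix.specialUnitaryGroup (Fin 3) ℂ) :=
          fun W e => if star e then W e else U e
        let F : GaugeConfig 4 L (Matrix.specialUnitaryGroup (Fin 3) ℂ) → ℝ :=
          fun W => ‖(diracMatrix (refit W) mq).det‖
        let wt : GaugeConfig 4 L (Matrix.specialUnitaryGroup (Fin 3) ℂ) → ℝ :=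
          fun W => Real.exp (-(β * wilsonAction (fundamentalRep (Fin 3)) (refit W)))
        let haar : MeasureTheory.Measure (GaugeConfig 4 L (Matrix.specialUnitaryGroup (Fin 3) ℂ)) :=
          MeasureTheory.Measure.pi fun _ => haarProbability (Matrix.specialUnitaryGroup (Fin 3) ℂ)
        let Z : ℝ := ∫ W, wt W ∂haar
        let M : ℝ := (∫ W, F W * wt W ∂haar) / Z
        (∀ W₀ : GaugeConfig 4 L (Matrix.specialUnitaryGroup (Fin 3) ℂ),
          F W₀ ≤ C * (1 + β) ^ p * M) ∧
        (0 < M → ∀ ε : ℝ, 0 < ε →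
          (∫ W, (if F W ≤ ε * M then (1 : ℝ) else 0) * wt W ∂haar) / Z ≤
            C * (1 + β) ^ p * ε ^ c)) := by
  open MeasureTheory Set Filter in
  rintro ⟨C, p, c, hC, hc, H⟩
  -- the free one-star fibre
  let refit : GaugeConfig 4 4 SU3 → GaugeConfig 4 4 SU3 := fun W e =>
    if (e.1 = (0 : TorusSite 4 4) ∨ Site.shift e.1 e.2 = 0 ∨ e.1 = 0 ∨ Site.shift e.1 e.2 = 0)
    then W e else (fun _ : Edge 4 4 => (1 : SU3)) e
  let G : GaugeConfig 4 4 SU3 → ℝ := fun W =>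
    ‖(wilsonDirac (fundamentalRep (Fin 3)) (refit W) 0 1).det‖
  let Sc : GaugeConfig 4 4 SU3 → ℝ := fun W => wilsonAction (fundamentalRep (Fin 3)) (refit W)
  let haar : Measure (GaugeConfig 4 4 SU3) := Measure.pi fun _ => haarProbability SU3
  haveI : haar.IsOpenPosMeasure := by
    show (Measure.pi fun _ : Edge 4 4 => haarProbability SU3).IsOpenPosMeasure
    unfold haarProbability; infer_instance
  haveI : IsProbabilityMeasure haar := by
    show IsProbabilityMeasure (Measure.pi fun _ : Edge 4 4 => haarProbability SU3)
    infer_instance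
  have hrefit_cont : Continuous refit := by
    refine continuous_pi fun e => ?_
    by_cases h : (e.1 = (0 : TorusSite 4 4) ∨ Site.shift e.1 e.2 = 0 ∨ e.1 = 0 ∨
        Site.shift e.1 e.2 = 0)
    · simp only [refit, if_pos h]; exact continuous_apply e
    · simp only [refit, if_neg h]; exact continuous_const
  have hG : Continuous G := continuous_normDetWilson_comp hrefit_cont 0
  have hG0 : ∀ W, 0 ≤ G W := fun W => norm_nonneg _
  -- `G = 0` at the trivial star, `G > 0` at the twisted one
  have hrefit_one : refit (fun _ => 1) = fun _ => 1 := by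
    funext e; simp only [refit]; split_ifs <;> rfl
  have hGzero : G (fun _ => 1) = 0 := by
    show ‖(wilsonDirac (fundamentalRep (Fin 3)) (refit fun _ => 1) 0 1).det‖ = 0
    rw [hrefit_one, norm_eq_zero]
    exact det_wilsonDirac_freeStar_eq_zero _ (fun e _ => rfl)
      (fun z i j _ => by simp [plaquetteHolonomy])
  let Wtw : GaugeConfig 4 4 SU3 := fun e => if e = ((0 : TorusSite 4 4), (0 : Fin 4)) then
    (⟨Matrix.diagonal ![Complex.I, Complex.I, -1], twist_mem_specialUnitaryGroup⟩ : SU3) else 1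
  have hrefit_tw : refit Wtw = Wtw := by
    funext e
    by_cases he : (e.1 = (0 : TorusSite 4 4) ∨ Site.shift e.1 e.2 = 0 ∨ e.1 = 0 ∨
        Site.shift e.1 e.2 = 0)
    · simp only [refit, if_pos he]
    · have hne : e ≠ ((0 : TorusSite 4 4), (0 : Fin 4)) := by
        rintro rfl; exact he (Or.inl rfl)
      simp only [refit, if_neg he, Wtw, if_neg hne]
  have hGpos : 0 < G Wtw := by
    show 0 < ‖(wilsonDirac (fundamentalRep (Fin 3)) (refit Wtw) 0 1).det‖
    rw [hrefit_tw]
    exact norm_pos_iff.mpr det_wilsonDirac_twisted_ne_zero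
  -- the level `θ` and the two Haar masses `q`, `a`
  set θ : ℝ := G Wtw / 2 with hθdef
  have hθ : 0 < θ := by rw [hθdef]; exact half_pos hGpos
  have hOo : IsOpen {W | θ < G W} := isOpen_lt continuous_const hG
  have hAo : IsOpen {W | G W < θ / 2} := isOpen_lt hG continuous_const
  set q : ℝ := haar.real {W | θ < G W} with hqdef
  set a : ℝ := haar.real {W | G W < θ / 2} with hadef
  have hq : 0 < q := by
    have h1 : 0 < haar {W | θ < G W} :=
      hOo.measure_pos haar ⟨Wtw, show θ < G Wtw by rw [hθdef]; linarith⟩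
    exact ENNReal.toReal_pos h1.ne' (measure_ne_top _ _)
  have ha : 0 < a := by
    have h1 : 0 < haar {W | G W < θ / 2} :=
      hAo.measure_pos haar
        ⟨fun _ => 1, show G (fun _ => 1) < θ / 2 by rw [hGzero]; exact half_pos hθ⟩
    exact ENNReal.toReal_pos h1.ne' (measure_ne_top _ _)
  -- the smallness `ε` with `C ε^c = a/2`, and the number of flavours `N`
  set ε : ℝ := (a / (2 * C)) ^ c⁻¹ with hε
  have haC : 0 < a / (2 * C) := div_pos ha (mul_pos two_pos hC)
  have hεpos : 0 < ε := Real.rpow_pos_of_pos haC _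
  have hCε : C * ε ^ c = a / 2 := by
    rw [hε, Real.rpow_inv_rpow haC.le hc.ne']
    field_simp
  obtain ⟨N, hN⟩ := exists_pow_lt_of_lt_one (mul_pos hεpos hq) (by norm_num : (1 / 2 : ℝ) < 1)
  -- lower bound on the `N`-flavour mean
  have hGN_int : Integrable (fun W => G W ^ N) haar := integrable_of_continuous (hG.pow N)
  have hMN : θ ^ N * q ≤ ∫ W, G W ^ N ∂haar := by
    calc θ ^ N * q = ∫ W in {W | θ < G W}, θ ^ N ∂haar := by
          rw [setIntegral_const, smul_eq_mul, mul_comm]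
      _ ≤ ∫ W in {W | θ < G W}, G W ^ N ∂haar :=
          setIntegral_mono_on (integrable_const _).integrableOn hGN_int.integrableOn
            hOo.measurableSet (fun W hW => pow_le_pow_left₀ hθ.le (le_of_lt hW) N)
      _ ≤ ∫ W, G W ^ N ∂haar :=
          setIntegral_le_integral hGN_int (Eventually.of_forall fun W => pow_nonneg (hG0 W) N)
  have hMNpos : 0 < ∫ W, G W ^ N ∂haar := lt_of_lt_of_le (mul_pos (pow_pos hθ N) hq) hMN
  have hball : ∀ W, G W < θ / 2 → G W ^ N ≤ ε * ∫ W, G W ^ N ∂haar := by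
    intro W hW
    calc G W ^ N ≤ (θ / 2) ^ N := pow_le_pow_left₀ (hG0 W) hW.le N
      _ = θ ^ N * (1 / 2) ^ N := by rw [← mul_pow]; ring
      _ ≤ θ ^ N * (ε * q) := mul_le_mul_of_nonneg_left hN.le (pow_nonneg hθ.le N)
      _ = ε * (θ ^ N * q) := by ring
      _ ≤ ε * ∫ W, G W ^ N ∂haar := mul_le_mul_of_nonneg_left hMN hεpos.le
  -- clause (b′) at `N_f = N`, `β = 0` on this fibre
  let FN : GaugeConfig 4 4 SU3 → ℝ := fun W =>
    ‖(diracMatrix (refit W) (fun _ : Fin N => (0 : ℝ))).det‖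
  have hFN : ∀ W, FN W = G W ^ N := by
    intro W
    show ‖(diracMatrix (refit W) (fun _ : Fin N => (0 : ℝ))).det‖ =
      ‖(wilsonDirac (fundamentalRep (Fin 3)) (refit W) 0 1).det‖ ^ N
    rw [norm_det_diracMatrix, Finset.prod_const, Finset.card_univ, Fintype.card_fin]
  have hFNc : Continuous FN := continuous_normDet_comp hrefit_cont _
  let Z0 : ℝ := ∫ W, Real.exp (-(0 * Sc W)) ∂haar
  let M0 : ℝ := (∫ W, FN W * Real.exp (-(0 * Sc W)) ∂haar) / Z0
  have hZ0 : Z0 = 1 := by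
    show ∫ W, Real.exp (-(0 * Sc W)) ∂haar = 1
    simp only [zero_mul, neg_zero, Real.exp_zero, integral_const, probReal_univ, one_smul]
  have hM0 : M0 = ∫ W, G W ^ N ∂haar := by
    show (∫ W, FN W * Real.exp (-(0 * Sc W)) ∂haar) / Z0 = _
    rw [hZ0, div_one]
    simp only [zero_mul, neg_zero, Real.exp_zero, mul_one, hFN]
  have hb := (H N 0 le_rfl (fun _ => 0) (fun _ => by norm_num) 4 le_rfl (fun _ => 1) 0 0).2
  have hb' : 0 < M0 → ∀ ε : ℝ, 0 < ε →
      (∫ W, (if FN W ≤ ε * M0 then (1 : ℝ) else 0) * Real.exp (-(0 * Sc W)) ∂haar) / Z0 ≤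
        C * (1 + 0) ^ p * ε ^ c := hb
  have hM0pos : 0 < M0 := by rw [hM0]; exact hMNpos
  have hfin := hb' hM0pos ε hεpos
  rw [hZ0, div_one, add_zero, Real.one_rpow, mul_one] at hfin
  simp only [zero_mul, neg_zero, Real.exp_zero, mul_one] at hfin
  -- the relative small ball contains `{G < θ/2}`, of Haar mass `a`
  have hmeas : Measurable fun W => if FN W ≤ ε * M0 then (1 : ℝ) else 0 :=
    Measurable.ite (measurableSet_le hFNc.measurable measurable_const) measurable_const
      measurable_const
  have hint : Integrable (fun W => if FN W ≤ ε * M0 then (1 : ℝ) else 0) haar := by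
    refine (integrable_const (1 : ℝ)).mono' hmeas.aestronglyMeasurable
      (Eventually.of_forall fun W => ?_)
    split_ifs <;> simp
  have hlow : a ≤ ∫ W, (if FN W ≤ ε * M0 then (1 : ℝ) else 0) ∂haar := by
    calc a = ∫ W in {W | G W < θ / 2}, (1 : ℝ) ∂haar := by
          rw [setIntegral_const, smul_eq_mul, mul_one]
      _ = ∫ W, {W | G W < θ / 2}.indicator (fun _ => (1 : ℝ)) W ∂haar :=
          (integral_indicator hAo.measurableSet).symm
      _ ≤ ∫ W, (if FN W ≤ ε * M0 then (1 : ℝ) else 0) ∂haar := by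
          refine integral_mono ((integrable_const (1 : ℝ)).indicator hAo.measurableSet) hint
            fun W => ?_
          by_cases hW : W ∈ {W | G W < θ / 2}
          · have hle : FN W ≤ ε * M0 := by
              rw [hFN, hM0]; exact hball W hW
            rw [indicator_of_mem hW, if_pos hle]
          · rw [indicator_of_notMem hW]
            split_ifs <;> norm_num
  have : a ≤ a / 2 := hlow.trans (hfin.trans_eq hCε)
  linarith

end NfDependence

end Summit.QuantumFields.QCD.Theorems.TiltedFlatnessNegative
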